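import Literature.NumberTheory.EllipticCurves.BurungaleSkinnerTianWan2024.CyclotomicPConverseOverQProofs
import Literature.NumberTheory.EllipticCurves.Castella2018.TamagawaQuadraticBaseChangeProofs
import Literature.NumberTheory.DiophantineGeometry.MinimalDiscriminantSmulProofs
import Literature.NumberTheory.DiophantineGeometry.MinimalDiscriminantRingOfIntegersProofs
import Literature.NumberTheory.DiophantineGeometry.LocalReductionProofs
import Literature.NumberTheory.EllipticCurves.PAdicBSD
import HarnessLib

/-!
# Burungale–Skinner–Tian–Wan Thm. 12.3 ("`p`-converse I") for an elliptic curve over `ℚ` at EVERY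
# `p ≥ 3` under print's own `p = 3` hypotheses (irr_ℚ) + (ram), REPLAYED IN THE KERNEL modulo the
# ordinary Prop. 12.1 OPEN binder and the REFEREED Skinner–Urban main conjecture

Paper of record: A. Burungale, C. Skinner, Y. Tian, X. Wan, *Zeta elements for elliptic curves and
applications*, arXiv:2409.01350v2 — an UNREFEREED PREPRINT. Typed ≠ proved ≠ endorsed. PROOFS ONLY:
this file introduces NO named fact and NO definition. Sequel of `CyclotomicPConverseOverQProofs`
(gen 5 of the typer seat `bsd-littype-01`, cross-ladder literature-typing layer D-0088(4)), written
by gen 6 of the same seat; it closes that file's "WEAKER than print at `p = 3`" caveat.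

WHAT PRINT SAYS (Thm. 12.3, p. 96, tex l.8146–8164): "Let `p ∤ 2N` be a prime such that `λ ∤ a_p` or
`a_p = 0` and `N` is square-free. If `g` does not have CM, then suppose that `ρ` satisfies (irr_ℚ)
and (ram) if `p = 3`. [Then] `corank Sel = 1`, `#Ш[λ^∞] < ∞ ⟹ ord_{s=1} L(s, A_g) = [F:ℚ]`", where
(ram) (p. 14, tex l.1270) is "there exists a prime `ℓ ∥ N` such that `ρ̄` is ramified at `ℓ`", in
the tree's spelling (Tate's parametrisation) `∃ ℓ ≠ p`, multiplicative reduction at `ℓ`,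
`p ∤ ord_ℓ(Δ_min)` — verbatim the hypothesis `haux` of the tree's named fact
`skinner_urban_main_conjecture` (bsd.S21, `PAdicBSD`). Step 5 of the printed proof (tex l.8174):
"By Theorem 9.21 (c) … Kato's main conjecture holds for `g` and the quadratic twist `g'` in
`Λ ⊗ ℚ_p`"; Thm. 9.21 (c) at `p = 3` under (irr_ℚ)+(ram) is, in REFEREED print, Skinner–Urban,
Invent. Math. 195 (2014), Thm. 3.6.9 (clause 2: equality in `Λ_ℚ ⊗ ℚ_p`), i.e. the tree's named
fact `skinner_urban_main_conjecture` for every `p ≥ 3`.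

WHAT IS PROVED HERE (0 facts, 0 definitions).

* §0 `charIdealLePadicLFunctionRat_of_skinnerUrban`: clause 2 of `skinner_urban_main_conjecture`
  (`char_Λ X = (g)`, `ι g = p^k · L_p(f, α)`, `k ∈ ℤ`; `p ≥ 3`, good ordinary, (irr_ℚ), (ram))
  SUPPLIES the ordinary one-sided rational predicate `CharIdealLePadicLFunctionRat W p` of
  `CyclotomicPConverseCriterionOPEN` — the same three-line computation as the sibling
  `charIdealLePadicLFunctionRat_of_bcs` (REFEREED BCS25 1.1.2 (a), `p ≥ 5`, no (ram)).
* §1 THE (ram)-TRANSFER LEMMA the printed proof leaves implicit ("the quadratic twist `g'`"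
  must satisfy the hypotheses of Thm. 9.21 (c) too): for the imaginary quadratic `L` of step 2
  every `ℓ ∣ N` SPLITS in `L` (Heeg), so `d_L ∈ (ℚ_ℓ^×)²` (tree theorem
  `Castella2018.TamagawaQuadratic.isSquare_padic_discr_of_splitsIn`: `(d_L/ℓ) = 1` and Hensel,
  `d_L ≡ 1 (mod 8)` at `ℓ = 2`) and `E^{(d_L)} ⊗ ℚ_ℓ ≅ E ⊗ ℚ_ℓ` OVER `ℚ_ℓ`
  (`Castella2018.TamagawaQuadratic.exists_baseChange_eq_smul_of_twist`); the reduction type at `ℓ`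
  and `ord_ℓ(Δ_min)` are `ℚ_ℓ`-isomorphism invariants (Silverman *AEC* VII.1 Prop. 1.3 (b), VII.5
  Prop. 5.1 (b): `hasMultiplicativeReductionAtPrime_iff_of_baseChange_eq_smul_baseChange`,
  `padicValInt_minimalDiscriminantInt_eq_of_baseChange_eq_smul_baseChange`, from the tree's DVR
  lemmas `hasMultiplicativeReduction_iff_of_isMinimal_of_eq_smul`,
  `valuation_Δ_eq_of_isMinimal_of_eq_smul`, `ordMinimalDiscriminant_eq_padic`,
  `ordMinimalDiscriminant_eq_padicValInt`). Hence (ram) for `E` at `p` ⟹ (ram) for any globally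
  minimal model of `E^{(d_L)}` at `p`, with the SAME `ℓ` — uniformly in `ℓ`, INCLUDING `ℓ = 2`
  (`exists_ram_twist_of_satisfiesHeegnerHypothesis`).
* §2 Thm. 12.3, ordinary branch, at every `p ≥ 3` under (irr_ℚ)+(ram), corank and rank forms
  (`analyticRank_eq_one_of_prop121_ordinary_OPEN_of_skinnerUrban_of_selmerCorank_eq_one`,
  `…_of_mordellWeilRank_eq_one`), and the Prop-12.1-rank-form-over-`K` corollary with Skinner–Urban
  in place of BCS (`analyticRankEK_eq_one_of_prop121_ordinary_OPEN_of_skinnerUrban_of_mordellWeilRank_eq_one`),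
  by the printed proof (steps 1–6 of the module docstring of `CyclotomicPConverseOverQProofs`) with
  step 5 now "Skinner–Urban Thm. 3.6.9 for `E` AND for a globally minimal model of `E^{(d_L)}`",
  the twist's (ram) coming from §1, its good ordinary reduction and (irr_ℚ) from gen 5's
  `isOrdinaryAt_of_smul_eq_quadraticTwist` / `hasIrreducibleModPGaloisRep_of_smul_eq_quadraticTwist`.

TRUST BASE of the §2 statements: ONE preprint binder (Prop. 12.1, ordinary branch,
`prop121_pConverse_of_charIdealLe_ordinary_OPEN`) + the REFEREED named facts
`skinner_urban_main_conjecture` (bsd.S21), `p_parity` (Dokchitser–Dokchitser / Nekovář),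
`friedbergHoffstein_exists_heegnerField_split_twist_ne_zero`, `kato_finite_of_L_one_ne_zero`
(Kato 14.2 / Cor. 14.3) and modularity `hasEntireLFunction_rat`. PROOF-INPUT FLAG POINTER: at
`p = 3` the instantiation `skinner_urban_main_conjecture W 3` (and `… W' 3` for the twist) carries
the ACTIVE-PRINT-GAP flag `SU14-12.3.6-mu@nonsplit@3` of its own docstring (carrier text of record:
`Skinner2016.thmC_padicValRat_bsd_rank_zero`; referee A R152.2 / C2 R334–R337 / C3 R362: the
µ-sentence of S–U Prop. 12.3.6 fails in every `p = 3` instance; refereed repair at `3`: none;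
announced only by THIS preprint's Thm. 1.21 (c)); the flag TRAVELS with the two `hSU` uses below and
is priced there (PUB at `p ≥ 5`, PUB\* at `p = 3`) — which is exactly print's own status at `3`
(BSTW Thm. 9.21 (c) at `3` = the preprint's claim). Nothing is asserted about any binder or fact.

FAITHFULNESS. Hypotheses of the §2 theorems = print's Thm. 12.3 for `A_g = E` at `p = 3`
((irr_ℚ) + (ram); WEAKER for CM curves, where print asks neither, citing [Ru1]); at `p ≥ 5` they
are print's plus (ram) (print asks (ram) only at `3`; the (ram)-free `p ≥ 5` statement is gen 5's
`analyticRank_eq_one_of_prop121_ordinary_OPEN_of_selmerCorank_eq_one` over BCS25) — never stronger.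
Conclusion identical (`ord_{s=1} L(E, s) = 1 = [ℚ:ℚ]`).

## References
* [BurungaleSkinnerTianWan2024] arXiv:2409.01350v2: Thm. 12.3 (p. 96; label p-converse,
  tex l.8146–8164) and its proof (l.8165–8177), Prop. 12.1 (p. 95; OPEN binder), (ram) (p. 14,
  l.1270), Thm. 9.21 (c) (p. 84).
* [SkinnerUrban2014] Invent. Math. 195 (2014), Thm. 3.6.9 (p. 45 of the author version) — the tree
  fact `skinner_urban_main_conjecture`.
* [SilvermanAEC2009] VII.1 Prop. 1.3 (b), VII.5 Prop. 5.1 (b), VIII.8 (global minimal equations),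
  X.5 Cor. 5.4 (twists by squares), Exercise 10.16.
* [NeukirchANT1999] Ch. I (8.5) (decomposition law in quadratic fields), Ch. II (4.6) (Hensel).
* [DokchitserDokchitserAnnals2010] Thm. 1.4; [FriedbergHoffstein1995] main theorem;
  [Kato2004Asterisque] Thm. 14.2 / Cor. 14.3.
-/

noncomputable section

open scoped Classical

open WeierstrassCurve NumberField IsDedekindDomain Rat.HeightOneSpectrum
  Literature.NumberTheory.EllipticCurves Literature.NumberTheory.EllipticCurves.Rank1Residual
  Literature.NumberTheory.EllipticCurves.Castella2018.TamagawaQuadratic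

namespace Literature.NumberTheory.EllipticCurves.BurungaleSkinnerTianWan2024

/-! ### §0. Skinner–Urban Thm. 3.6.9 (clause 2) supplies the ordinary one-sided rational predicate -/

/-- Clearing denominators in `ℚ_p`: some `pⁿ · x` is a `p`-adic integer (private twin of the
sibling file's helper). [folklore] -/
private theorem exists_pow_mul_eq_coe' (p : ℕ) [Fact p.Prime] (x : ℚ_[p]) :
    ∃ (n : ℕ) (X : ℤ_[p]), (X : ℚ_[p]) = (p : ℚ_[p]) ^ n * x := by
  by_cases hx : x = 0
  · exact ⟨0, 0, by simp [hx]⟩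
  have hp : (p : ℝ) ≠ 0 := by exact_mod_cast (Fact.out : p.Prime).ne_zero
  have hn := Padic.norm_eq_zpow_neg_valuation hx
  refine ⟨(-x.valuation).toNat, ⟨(p : ℚ_[p]) ^ (-x.valuation).toNat * x, ?_⟩, rfl⟩
  rw [norm_mul, norm_pow, Padic.norm_p, hn, inv_pow, ← zpow_natCast, ← zpow_neg, ← zpow_add₀ hp]
  have hp1 : (1 : ℝ) ≤ p := by exact_mod_cast (Fact.out : p.Prime).one_lt.le
  calc (p : ℝ) ^ (-((-x.valuation).toNat : ℤ) + -x.valuation) ≤ (p : ℝ) ^ (0 : ℤ) := by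
        apply zpow_le_zpow_right₀ hp1
        omega
    _ = 1 := zpow_zero _

/-- `ι(C X) = C X` for the inclusion `ι : Λ = ℤ_p⟦T⟧ ↪ ℚ_p⟦T⟧`. [folklore] -/
private theorem iwasawaToPowerSeries_C'' (p : ℕ) [Fact p.Prime] (X : ℤ_[p]) :
    iwasawaToPowerSeries p (PowerSeries.C X) = PowerSeries.C (X : ℚ_[p]) := by
  simp [iwasawaToPowerSeries, PowerSeries.map_C]

/-- `ι(m) = C m`. [folklore] -/
private theorem iwasawaToPowerSeries_natCast'' (p : ℕ) [Fact p.Prime] (m : ℕ) :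
    iwasawaToPowerSeries p (m : IwasawaAlgebra p) = PowerSeries.C (m : ℚ_[p]) := by
  rw [map_natCast, map_natCast]

/-- **The tree's REFEREED fact Skinner–Urban 2014 Thm. 3.6.9, clause 2** — Mazur's main conj. in
`Λ ⊗ ℚ_p` (`char_Λ X = (g)`, `ι g = p^k · L_p(f, α)`, `k ∈ ℤ`) at a prime `p ≥ 3` of good ordinary
reduction with `E[p]` irreducible AND (ram) (`∃ ℓ ≠ p` of multiplicative reduction with
`p ∤ ord_ℓ(Δ_min)`) — **supplies the ordinary one-sided rational predicate**
`CharIdealLePadicLFunctionRat W p` (indeed both halves): with `ϖ · Ω_E = Ω⁺_f` one has `ϖ ≠ 0`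
(`Ω⁺_f > 0`, tree theorem `IsNewform0.plusPeriod_pos_holds`), and `pⁿ · p^k · ϖ⁻¹ ∈ ℤ_p` for `n`
large gives `ι(pⁿ g) = ι(C(pⁿ p^k ϖ⁻¹)) · ϖ · L_p`. Same computation as the sibling
`charIdealLePadicLFunctionRat_of_bcs` (BCS25 1.1.2 (a), `p ≥ 5`, no (ram)); this is the `p ≥ 3`
supplier, in particular the ONLY refereed one at `p = 3` (flag `SU14-12.3.6-mu@nonsplit@3` travels
with the instantiation `hSU W 3`, module docstring). `hSU` is the tree fact quantified as its
consumers do (`LeadingTermPPartProofs`, `MainConjecturesRankZeroFactsDerived`).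
[cite: SkinnerUrban2014, Thm. 3.6.9 (p. 45 of the author version), clause "in Λ_ℚ ⊗ ℚ_p"]
[cite: BurungaleSkinnerTianWan2024, statement 9.3 (b) (p. 79) with Lemma 9.16 (i) (p. 82) and Thm. 9.21 (c) (p. 84) (shape only)] -/
theorem charIdealLePadicLFunctionRat_of_skinnerUrban
    (hSU : ∀ (W : WeierstrassCurve ℚ) [W.IsElliptic] [W.IsGloballyMinimal] (p : ℕ) [Fact p.Prime]
      (κ : ZpExtension ℚ p) (γ : Field.absoluteGaloisGroup ℚ) (N : ℕ) [NeZero N]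
      (f : CuspForm (CongruenceSubgroup.Gamma0 N) 2),
      skinner_urban_main_conjecture W p (κ := κ) (γ := γ) (f := f))
    (W : WeierstrassCurve ℚ) [W.IsElliptic] [W.IsGloballyMinimal] (p : ℕ) [Fact p.Prime]
    (hp : 3 ≤ p) (hgood : W.HasGoodReductionAtPrime p) (hord : ¬ (p : ℤ) ∣ W.frobeniusTrace p)
    (hirr : W.HasIrreducibleModPGaloisRep p)
    (hram : ∃ ℓ : ℕ, ∃ _ : Fact ℓ.Prime, ℓ ≠ p ∧ W.HasMultiplicativeReductionAtPrime ℓ ∧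
      ¬ p ∣ padicValInt ℓ W.minimalDiscriminantInt) :
    CharIdealLePadicLFunctionRat W p := by
  intro κ γ hκ hγ hγ' _ f hf ϖ hϖ D
  obtain ⟨htors, ⟨g, k, hchar, hι⟩, -⟩ :=
    hSU W p κ γ (W.conductorNorm ℤ) f hp hgood hord hirr hram hκ hγ hγ' hf D
  -- `ϖ ≠ 0` since `Ω⁺_f > 0`
  have hpos : 0 < ModularForms.plusPeriod f :=
    ModularForms.IsNewform0.plusPeriod_pos_holds hf.1 hf.coeffField_eq_bot
  have hϖ0 : (ϖ : ℚ_[p]) ≠ 0 := by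
    have hϖ0' : ϖ ≠ 0 := by
      rintro rfl
      rw [Rat.cast_zero, zero_mul] at hϖ
      exact hpos.ne' hϖ.symm
    exact_mod_cast hϖ0'
  have hpQ : (p : ℚ_[p]) ≠ 0 := by exact_mod_cast (Fact.out : p.Prime).ne_zero
  -- clear the denominator of `p^k · ϖ⁻¹`
  obtain ⟨n, X, hX⟩ := exists_pow_mul_eq_coe' p ((p : ℚ_[p]) ^ k * (ϖ : ℚ_[p])⁻¹)
  refine ⟨htors, g, PowerSeries.C X, n, hchar, ?_⟩
  rw [map_mul, map_pow, iwasawaToPowerSeries_natCast'', hι, iwasawaToPowerSeries_C'', hX,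
    ← mul_assoc (PowerSeries.C _) (PowerSeries.C _), ← map_mul, ← map_pow, ← mul_assoc,
    ← map_mul]
  congr 2
  field_simp

/-! ### §1. The (ram)-transfer lemma: reduction type and `ord_ℓ(Δ_min)` are `ℚ_ℓ`-isomorphism
invariants; a prime split in `L` sees `E^{(d_L)} ⊗ ℚ_ℓ ≅ E ⊗ ℚ_ℓ` -/

/-- **The reduction type at `q` is a `ℚ_q`-isomorphism invariant** (multiplicative case): if
`W' ⊗ ℚ_q = D • (W ⊗ ℚ_q)` for a change of variables `D` over `ℚ_q` (`W` elliptic), then `W'` has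
multiplicative reduction at `q` iff `W` has — the two chosen `ℤ_q`-minimal models differ by a change
of variables over `ℚ_q`, and multiplicative reduction of a minimal equation only depends on `v(Δ)`,
`v(c₄)`, which agree (tree `hasMultiplicativeReduction_iff_of_isMinimal_of_eq_smul`; Silverman
*AEC* VII.5 Prop. 5.1 (b) with VII.1 Prop. 1.3 (b)). Twin of the tree's
`hasSplitMultiplicativeReductionAtPrime_iff_of_baseChange_eq_smul`.
[cite: SilvermanAEC2009, VII.5 Prop. 5.1(b) (PDF p. 174) and VII.1 Prop. 1.3(b) (PDF p. 165)] -/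
theorem hasMultiplicativeReductionAtPrime_iff_of_baseChange_eq_smul_baseChange
    (W W' : WeierstrassCurve ℚ) [W.IsElliptic] {q : ℕ} [Fact q.Prime] {D : VariableChange ℚ_[q]}
    (hD : W'.baseChange ℚ_[q] = D • W.baseChange ℚ_[q]) :
    W'.HasMultiplicativeReductionAtPrime q ↔ W.HasMultiplicativeReductionAtPrime q := by
  unfold HasMultiplicativeReductionAtPrime
  haveI : (W.baseChange ℚ_[q]).IsElliptic :=
    inferInstanceAs (W.map (algebraMap ℚ ℚ_[q])).IsElliptic
  have hmin : (W.baseChange ℚ_[q]).minimal ℤ_[q] =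
      ((W.baseChange ℚ_[q]).exists_isMinimal ℤ_[q]).choose • W.baseChange ℚ_[q] := rfl
  have hmin' : (W'.baseChange ℚ_[q]).minimal ℤ_[q] =
      ((W'.baseChange ℚ_[q]).exists_isMinimal ℤ_[q]).choose • W'.baseChange ℚ_[q] := rfl
  -- the two chosen minimal models differ by a change of variables over `ℚ_q`
  have h : (W'.baseChange ℚ_[q]).minimal ℤ_[q] =
      (((W'.baseChange ℚ_[q]).exists_isMinimal ℤ_[q]).choose * D *
          (((W.baseChange ℚ_[q]).exists_isMinimal ℤ_[q]).choose)⁻¹) •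
        (W.baseChange ℚ_[q]).minimal ℤ_[q] := by
    rw [mul_smul, mul_smul, hmin, inv_smul_smul, ← hD, ← hmin']
  haveI : ((W.baseChange ℚ_[q]).minimal ℤ_[q]).IsElliptic := by
    rw [hmin]
    infer_instance
  exact hasMultiplicativeReduction_iff_of_isMinimal_of_eq_smul ℤ_[q] h
    ((W.baseChange ℚ_[q]).minimal ℤ_[q]).isUnit_Δ.ne_zero

/-- **`ord_q(Δ_min)` is a `ℚ_q`-isomorphism invariant**: for `W, W'/ℚ` globally minimal with
`W' ⊗ ℚ_q = D • (W ⊗ ℚ_q)` over `ℚ_q`, `ord_q Δ_min(W') = ord_q Δ_min(W)` — the chosen `ℤ_q`-minimal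
models differ by a change of variables over `ℚ_q`, so their discriminants have the same valuation
(tree `valuation_Δ_eq_of_isMinimal_of_eq_smul`, Silverman *AEC* VII.1 Prop. 1.3 (b)), and for a
global minimal equation `ord_q Δ_min = ord_q(minimalDiscriminantInt)` (tree
`ordMinimalDiscriminant_eq_padicValInt`, `ordMinimalDiscriminant_eq_padic`; *AEC* VIII.8).
[cite: SilvermanAEC2009, VII.1 Prop. 1.3(b) (PDF p. 165) and VIII.8 (global minimal equations, PDF p. 211)] -/
theorem padicValInt_minimalDiscriminantInt_eq_of_baseChange_eq_smul_baseChange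
    (W W' : WeierstrassCurve ℚ) [W.IsElliptic] [W.IsGloballyMinimal] [W'.IsElliptic]
    [W'.IsGloballyMinimal] {q : ℕ} [Fact q.Prime] {D : VariableChange ℚ_[q]}
    (hD : W'.baseChange ℚ_[q] = D • W.baseChange ℚ_[q]) :
    padicValInt q W'.minimalDiscriminantInt = padicValInt q W.minimalDiscriminantInt := by
  obtain ⟨v, hv⟩ : ∃ v : HeightOneSpectrum (𝓞 ℚ), ((primesEquiv v : ℕ)) = q :=
    ⟨primesEquiv.symm ⟨q, Fact.out⟩, by rw [Equiv.apply_symm_apply]⟩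
  rw [← ordMinimalDiscriminant_eq_padicValInt W v hv, ← ordMinimalDiscriminant_eq_padicValInt W' v hv]
  subst hv
  -- the two chosen `ℤ_q`-minimal models differ by a change of variables over `ℚ_q`
  have hmin : (W.baseChange ℚ_[(primesEquiv v : ℕ)]).minimal ℤ_[(primesEquiv v : ℕ)] =
      ((W.baseChange ℚ_[(primesEquiv v : ℕ)]).exists_isMinimal ℤ_[(primesEquiv v : ℕ)]).choose •
        W.baseChange ℚ_[(primesEquiv v : ℕ)] := rfl
  have hmin' : (W'.baseChange ℚ_[(primesEquiv v : ℕ)]).minimal ℤ_[(primesEquiv v : ℕ)] =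
      ((W'.baseChange ℚ_[(primesEquiv v : ℕ)]).exists_isMinimal ℤ_[(primesEquiv v : ℕ)]).choose •
        W'.baseChange ℚ_[(primesEquiv v : ℕ)] := rfl
  have h : (W'.baseChange ℚ_[(primesEquiv v : ℕ)]).minimal ℤ_[(primesEquiv v : ℕ)] =
      (((W'.baseChange ℚ_[(primesEquiv v : ℕ)]).exists_isMinimal ℤ_[(primesEquiv v : ℕ)]).choose * D *
          (((W.baseChange ℚ_[(primesEquiv v : ℕ)]).exists_isMinimal ℤ_[(primesEquiv v : ℕ)]).choose)⁻¹) •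
        (W.baseChange ℚ_[(primesEquiv v : ℕ)]).minimal ℤ_[(primesEquiv v : ℕ)] := by
    rw [mul_smul, mul_smul, hmin, inv_smul_smul, ← hD, ← hmin']
  rw [ordMinimalDiscriminant_eq_padic v W, ordMinimalDiscriminant_eq_padic v W']
  congr 1
  apply IsDiscreteValuationRing.addVal_eq_addVal_of_valuation_algebraMap_eq
    ℤ_[(primesEquiv v : ℕ)] (L := ℚ_[(primesEquiv v : ℕ)])
  rw [integralModel_Δ_eq, integralModel_Δ_eq]
  exact valuation_Δ_eq_of_isMinimal_of_eq_smul ℤ_[(primesEquiv v : ℕ)] h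

/-- **(ram) is preserved by a twist which is a square in `ℚ_ℓ`.** For `W, W'/ℚ` globally minimal,
`C • W' = W^{(d)}` and `d ∈ (ℚ_ℓ^×)²`: `W' ⊗ ℚ_ℓ ≅ W ⊗ ℚ_ℓ` over `ℚ_ℓ` (tree
`Castella2018.TamagawaQuadratic.exists_baseChange_eq_smul_of_twist`, Silverman *AEC* X.5 Cor. 5.4),
hence `W'` is multiplicative at `ℓ` iff `W` is, and `ord_ℓ Δ_min(W') = ord_ℓ Δ_min(W)`.
[cite: SilvermanAEC2009, X.5 Cor. 5.4 (twists by squares are isomorphic over the ground field), VII.5 Prop. 5.1(b), VII.1 Prop. 1.3(b)] -/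
theorem hasMultiplicativeReductionAtPrime_iff_and_padicValInt_eq_of_smul_eq_quadraticTwist_of_isSquare
    (W W' : WeierstrassCurve ℚ) [W.IsElliptic] [W.IsGloballyMinimal] [W'.IsElliptic]
    [W'.IsGloballyMinimal] {d : ℚ} (hd : d ≠ 0) {C : VariableChange ℚ}
    (hC : C • W' = W.quadraticTwist d) (ℓ : ℕ) [Fact ℓ.Prime] (hsq : IsSquare ((d : ℚ) : ℚ_[ℓ])) :
    (W'.HasMultiplicativeReductionAtPrime ℓ ↔ W.HasMultiplicativeReductionAtPrime ℓ) ∧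
      padicValInt ℓ W'.minimalDiscriminantInt = padicValInt ℓ W.minimalDiscriminantInt := by
  have hC' : C⁻¹ • W.quadraticTwist d = W' := by rw [← hC, inv_smul_smul]
  obtain ⟨D, hD⟩ := exists_baseChange_eq_smul_of_twist W hd hsq W' hC'
  exact ⟨hasMultiplicativeReductionAtPrime_iff_of_baseChange_eq_smul_baseChange W W' hD,
    padicValInt_minimalDiscriminantInt_eq_of_baseChange_eq_smul_baseChange W W' hD⟩

/-- **THE (ram)-TRANSFER LEMMA of the proof of Thm. 12.3.** Let `W/ℚ` be globally minimal, `L = K`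
a quadratic field in which every prime factor of `N_E` splits (Heeg), and `W'` a globally minimal
model of `E^{(d_K)}` (`C • W' = W^{(d_K)}`). If (ram) holds for `E` at `p` — a prime `ℓ ≠ p` of
multiplicative reduction with `p ∤ ord_ℓ(Δ_min(E))` — then (ram) holds for `E^{(d_K)}` at `p`
with the SAME `ℓ`: `ℓ ∣ N_E` (a multiplicative prime is bad, tree
`dvd_conductorNorm_iff_not_hasGoodReductionAtPrime`) splits in `K`, so `d_K ∈ (ℚ_ℓ^×)²`
(`isSquare_padic_discr_of_splitsIn`: decomposition law + Hensel, `d_K ≡ 1 (mod 8)` when `ℓ = 2`)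
and the previous lemma applies. Uniform in `ℓ`, including `ℓ = 2`. This is what "Kato's main
conjecture holds for … the quadratic twist `g'`" (proof of Thm. 12.3, step 5, tex l.8174, via
Thm. 9.21 (c) whose `p = 3` case needs (ram) for `g'`) leaves implicit.
[cite: BurungaleSkinnerTianWan2024, proof of Thm. 12.3 (p. 96, tex l.8170–8175) with (ram) (p. 14, l.1270) (bookkeeping only; nothing of the preprint asserted)]
[cite: NeukirchANT1999, Ch. I (8.5) Prop. and Ch. II (4.6)] [cite: SilvermanAEC2009, X.5 Cor. 5.4, VII.5 Prop. 5.1(b)] -/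
theorem exists_ram_twist_of_satisfiesHeegnerHypothesis (W W' : WeierstrassCurve ℚ) [W.IsElliptic]
    [W.IsGloballyMinimal] [W'.IsElliptic] [W'.IsGloballyMinimal] (K : Type) [Field K]
    [NumberField K] (h2 : Module.finrank ℚ K = 2)
    (hH : SatisfiesHeegnerHypothesis (W.conductorNorm ℤ) K) {C : VariableChange ℚ}
    (hC : C • W' = W.quadraticTwist (NumberField.discr K : ℚ)) (p : ℕ)
    (hram : ∃ ℓ : ℕ, ∃ _ : Fact ℓ.Prime, ℓ ≠ p ∧ W.HasMultiplicativeReductionAtPrime ℓ ∧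
      ¬ p ∣ padicValInt ℓ W.minimalDiscriminantInt) :
    ∃ ℓ : ℕ, ∃ _ : Fact ℓ.Prime, ℓ ≠ p ∧ W'.HasMultiplicativeReductionAtPrime ℓ ∧
      ¬ p ∣ padicValInt ℓ W'.minimalDiscriminantInt := by
  obtain ⟨ℓ, hℓ, hℓp, hmult, hval⟩ := hram
  -- `ℓ ∣ N_E` splits in `K`, so `d_K` is a square in `ℚ_ℓ`
  have hℓN : ℓ ∣ W.conductorNorm ℤ :=
    (W.dvd_conductorNorm_iff_not_hasGoodReductionAtPrime ℓ).mpr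
      (WeierstrassCurve.HasMultiplicativeReduction.not_hasGoodReduction (R := ℤ_[ℓ]) hmult)
  have hsplit : ((Ideal.span {(ℓ : ℤ)}).primesOver (𝓞 K)).ncard = 2 := hH ℓ hℓ.out hℓN
  have hsq : IsSquare (((NumberField.discr K : ℚ) : ℚ) : ℚ_[ℓ]) :=
    isSquare_padic_discr_of_splitsIn h2 hsplit
  have hd : (NumberField.discr K : ℚ) ≠ 0 := by exact_mod_cast NumberField.discr_ne_zero K
  obtain ⟨hiff, hΔ⟩ :=
    hasMultiplicativeReductionAtPrime_iff_and_padicValInt_eq_of_smul_eq_quadraticTwist_of_isSquare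
      W W' hd hC ℓ hsq
  exact ⟨ℓ, hℓ, hℓp, hiff.mpr hmult, by rwa [hΔ]⟩

/-! ### §2. Thm. 12.3, ordinary branch, at every `p ≥ 3` under (irr_ℚ) + (ram), modulo the
Prop. 12.1 binder + Skinner–Urban + REFEREED print -/

/-- **(Heeg) ⟹ (coprime)** (private twin of the sibling file's helper: a split prime is unramified,
Dedekind; BSTW (9.9)). [folklore] -/
private theorem isCoprime_discr_of_satisfiesHeegnerHypothesis'' {K : Type*} [Field K] [NumberField K]
    (hK : IsImaginaryQuadratic K) {N : ℕ} (hH : SatisfiesHeegnerHypothesis N K) :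
    IsCoprime (NumberField.discr K) (N : ℤ) := by
  refine IsCoprime.symm ?_
  rw [Int.isCoprime_iff_gcd_eq_one, Int.gcd_eq_natAbs, Int.natAbs_natCast]
  refine Nat.Coprime.gcd_eq_one (Nat.coprime_of_dvd fun k hk hkN hkd ↦ ?_)
  exact not_dvd_discr_of_satisfiesHeegnerHypothesis hK hH hk hkN (Int.ofNat_dvd_left.mpr hkd)

/-- **Prop. 12.1, ordinary branch (OPEN binder), in RANK form over `L = K`, with the REFEREED
Skinner–Urban Thm. 3.6.9 supplying BOTH cyclotomic divisibilities** — at `p ≥ 3` of good ordinary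
reduction for `E` with `E[p]` irreducible and (ram) FOR `E` ONLY: the twist `E^{(d_K)}`'s good
ordinary reduction, (irr_ℚ) and (ram) are DERIVED (`isOrdinaryAt_of_smul_eq_quadraticTwist` via the
squarefree kernel of `d_K`, `hasIrreducibleModPGaloisRep_of_smul_eq_quadraticTwist`,
`exists_ram_twist_of_satisfiesHeegnerHypothesis`). For `K` imaginary quadratic with `p` split,
(Heeg) for `N_E` ((coprime) follows), `W'` ANY globally minimal model of `E^{(d_K)}`:
`rank_ℤ E(K) = 1 ∧ #Ш(E/K)[p^∞] < ∞ ⟹ ord_{s=1} L(E/K, s) = 1`. The deep input is the OPEN binder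
`h121`; the flag `SU14-12.3.6-mu@nonsplit@3` travels with `hSU` at `p = 3` (module docstring).
[claim: BurungaleSkinnerTianWan2024, status: under-review]
[cite: BurungaleSkinnerTianWan2024, Prop. 12.1 (p. 95; OPEN binder) and proof of Thm. 12.3 (p. 96, tex l.8165–8177)]
[cite: SkinnerUrban2014, Thm. 3.6.9 (p. 45 of the author version)] -/
theorem analyticRankEK_eq_one_of_prop121_ordinary_OPEN_of_skinnerUrban_of_mordellWeilRank_eq_one
    (h121 : prop121_pConverse_of_charIdealLe_ordinary_OPEN.{0})
    (hSU : ∀ (W : WeierstrassCurve ℚ) [W.IsElliptic] [W.IsGloballyMinimal] (p : ℕ) [Fact p.Prime]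
      (κ : ZpExtension ℚ p) (γ : Field.absoluteGaloisGroup ℚ) (N : ℕ) [NeZero N]
      (f : CuspForm (CongruenceSubgroup.Gamma0 N) 2),
      skinner_urban_main_conjecture W p (κ := κ) (γ := γ) (f := f))
    (W W' : WeierstrassCurve ℚ) [W.IsElliptic] [W.IsGloballyMinimal] [W'.IsElliptic]
    [W'.IsGloballyMinimal] (K : Type) [Field K] [NumberField K] (p : ℕ) [Fact p.Prime]
    {C : VariableChange ℚ} (hp : 3 ≤ p) (hgood : W.HasGoodReductionAtPrime p)
    (hord : ¬ (p : ℤ) ∣ W.frobeniusTrace p) (hirr : W.HasIrreducibleModPGaloisRep p)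
    (hram : ∃ ℓ : ℕ, ∃ _ : Fact ℓ.Prime, ℓ ≠ p ∧ W.HasMultiplicativeReductionAtPrime ℓ ∧
      ¬ p ∣ padicValInt ℓ W.minimalDiscriminantInt)
    (hK : IsImaginaryQuadratic K) (hsplit : ((Ideal.span {(p : ℤ)}).primesOver (𝓞 K)).ncard = 2)
    (hH : SatisfiesHeegnerHypothesis (W.conductorNorm ℤ) K)
    (hC : C • W' = W.quadraticTwist (NumberField.discr K : ℚ))
    (hrank : (W.baseChange K).mordellWeilRank = 1)
    (hsha : Finite (AddCommGroup.primaryComponent (W.baseChange K).sha p)) :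
    analyticRankEK W K = 1 := by
  have hpP : p.Prime := Fact.out
  have hp2 : p ≠ 2 := by omega
  have hcop : IsCoprime (NumberField.discr K) (W.conductorNorm ℤ) :=
    isCoprime_discr_of_satisfiesHeegnerHypothesis'' hK hH
  have hpd : ¬ (p : ℤ) ∣ NumberField.discr K :=
    not_dvd_discr_of_satisfiesHeegnerHypothesis hK (fun q hq hqp ↦ by
      rwa [(Nat.prime_dvd_prime_iff_eq hq hpP).mp hqp]) hpP dvd_rfl
  -- the twist: good ordinary at `p` with irreducible `p`-torsion (through the squarefree kernel)
  obtain ⟨m, f, hsq, -, hf, hdK, -⟩ := exists_squarefree_discr_eq_mul_sq hK.1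
  have hmd : m ∣ NumberField.discr K := ⟨f ^ 2, by rw [hdK]⟩
  have hpm : ¬ (p : ℤ) ∣ m := fun h ↦ hpd (h.trans hmd)
  have hfQ : (f : ℚ) ≠ 0 := by exact_mod_cast hf
  obtain ⟨C₀, hC₀⟩ := W.exists_variableChange_quadraticTwist_mul_sq (m : ℚ) (f : ℚ) hfQ
  have hcast : (NumberField.discr K : ℚ) = (m : ℚ) * (f : ℚ) ^ 2 := by
    rw [hdK]; push_cast; ring
  have hC' : (C₀⁻¹ * C) • W' = W.quadraticTwist (m : ℚ) := by
    rw [mul_smul, hC, hcast, ← hC₀, inv_smul_smul]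
  have hord' : IsOrdinaryAt W' p :=
    isOrdinaryAt_of_smul_eq_quadraticTwist W W' hsq hC' p hp2 hpm ⟨hgood, hord⟩
  have hd0 : (NumberField.discr K : ℚ) ≠ 0 := by exact_mod_cast NumberField.discr_ne_zero K
  have hirr' : W'.HasIrreducibleModPGaloisRep p :=
    hasIrreducibleModPGaloisRep_of_smul_eq_quadraticTwist W W' p hd0 hC hirr
  -- (ram) for the twist, with the same `ℓ`
  have hram' := exists_ram_twist_of_satisfiesHeegnerHypothesis W W' K hK.1 hH hC p hram
  exact analyticRankEK_eq_one_of_prop121_ordinary_OPEN_of_mordellWeilRank_eq_one h121 W W' K p hp2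
    hgood hord hK hsplit hcop hH hC
    (charIdealLePadicLFunctionRat_of_skinnerUrban hSU W p hp hgood hord hirr hram)
    (charIdealLePadicLFunctionRat_of_skinnerUrban hSU W' p hp hord'.1 hord'.2 hirr' hram') hrank hsha

/-- **Burungale–Skinner–Tian–Wan Thm. 12.3 ("`p`-converse I"), ordinary branch, for an elliptic
curve at EVERY `p ≥ 3` under (irr_ℚ) + (ram) — REPLAYED from the printed proof (p. 96) modulo the
Prop. 12.1 OPEN binder and named REFEREED print, Skinner–Urban Thm. 3.6.9 in place of BCS25.**
Granted: `h121` the ordinary Prop. 12.1 binder (PREPRINT, OPEN — NEVER a theorem), `hSU` the REFEREED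
Skinner–Urban main conjecture (tree fact `skinner_urban_main_conjecture`, bsd.S21; at `p = 3` its
PROOF-INPUT FLAG `SU14-12.3.6-mu@nonsplit@3` travels, module docstring), `hpar` the `p`-parity
theorem, `hFH` the Friedberg–Hoffstein field, `hKato` Kato's Thm. 14.2 and `hE` modularity. Then for
`W/ℚ` globally minimal, `p ≥ 3` a prime of good ordinary reduction with `E[p]` irreducible and (ram)
(`∃ ℓ ≠ p` multiplicative with `p ∤ ord_ℓ(Δ_min)`):
`corank_{ℤ_p} Sel_{p^∞}(E/ℚ) = 1 ∧ #Ш(E/ℚ)[p^∞] < ∞ ⟹ ord_{s=1} L(E, s) = 1`.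
Proof = the printed one (steps 1–6): parity ⇒ `w(E) = −1`; FH field `K` with (Heeg), (ord) and
`L(E^{(d_K)}, 1) ≠ 0`; Kato ⇒ `Sel_{p^∞}(E^{(d_K)})` finite; base change ⇒ `rank E(K) = 1`,
`Ш(E/K)[p^∞]` finite; Skinner–Urban for `E` and for a globally minimal model of `E^{(d_K)}` (whose
good ordinary reduction, (irr_ℚ) AND (ram) — §1 — are proved); Prop. 12.1 (rank form) ⇒
`ord L(E/K) = 1 = ord L(E) + ord L(E^{(d_K)}) = ord L(E) + 0`. At `p = 3` these are EXACTLY print's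
hypotheses for non-CM `E` (WEAKER for CM curves); at `p ≥ 5` print does not ask (ram) (see gen 5's
BCS-based `analyticRank_eq_one_of_prop121_ordinary_OPEN_of_selmerCorank_eq_one`).
[claim: BurungaleSkinnerTianWan2024, status: under-review]
[cite: BurungaleSkinnerTianWan2024, Thm. 12.3 and its proof (p. 96; tex l.8146–8177) with (ram) (p. 14, l.1270), Prop. 12.1 (p. 95; OPEN binder)]
[cite: SkinnerUrban2014, Thm. 3.6.9 (p. 45 of the author version)] -/
theorem analyticRank_eq_one_of_prop121_ordinary_OPEN_of_skinnerUrban_of_selmerCorank_eq_one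
    (h121 : prop121_pConverse_of_charIdealLe_ordinary_OPEN.{0})
    (hSU : ∀ (W : WeierstrassCurve ℚ) [W.IsElliptic] [W.IsGloballyMinimal] (p : ℕ) [Fact p.Prime]
      (κ : ZpExtension ℚ p) (γ : Field.absoluteGaloisGroup ℚ) (N : ℕ) [NeZero N]
      (f : CuspForm (CongruenceSubgroup.Gamma0 N) 2),
      skinner_urban_main_conjecture W p (κ := κ) (γ := γ) (f := f))
    (hpar : ∀ (W : WeierstrassCurve ℚ) [W.IsElliptic] (p : ℕ) [Fact p.Prime], p_parity W p)
    (hFH : friedbergHoffstein_exists_heegnerField_split_twist_ne_zero)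
    (hKato : ∀ (W : WeierstrassCurve ℚ) [W.IsElliptic] (p : ℕ) [Fact p.Prime],
      kato_finite_of_L_one_ne_zero W p)
    (hE : hasEntireLFunction_rat)
    (W : WeierstrassCurve ℚ) [W.IsElliptic] [W.IsGloballyMinimal] (p : ℕ) [Fact p.Prime]
    (hp : 3 ≤ p) (hgood : W.HasGoodReductionAtPrime p) (hord : ¬ (p : ℤ) ∣ W.frobeniusTrace p)
    (hirr : W.HasIrreducibleModPGaloisRep p)
    (hram : ∃ ℓ : ℕ, ∃ _ : Fact ℓ.Prime, ℓ ≠ p ∧ W.HasMultiplicativeReductionAtPrime ℓ ∧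
      ¬ p ∣ padicValInt ℓ W.minimalDiscriminantInt)
    (hcorank : W.selmerCorank p = 1)
    (hsha : Finite (AddCommGroup.primaryComponent W.sha p)) : W.analyticRank = 1 := by
  have hpP : p.Prime := Fact.out
  -- step 1: parity, `w(E) = -1`
  have hw : W.rootNumber = -1 := by
    have h := hpar W p
    unfold p_parity at h
    rw [hcorank, pow_one] at h
    exact h.symm
  -- rank `1` over `ℚ`
  haveI := hsha
  have hrank : W.mordellWeilRank = 1 := mordellWeilRank_eq_one_of_selmerCorank_eq_one W p hcorank
  -- step 2: the Friedberg–Hoffstein field `K` with (Heeg), (ord) and `L(E^{(d_K)}, 1) ≠ 0`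
  obtain ⟨K, _, _, hK, -, hHN, hHp, hL1⟩ := hFH W hw p hpP 0
  have hsplit : ((Ideal.span {(p : ℤ)}).primesOver (𝓞 K)).ncard = 2 := hHp p hpP dvd_rfl
  -- steps 3–4: Kato for the twist and base change: `rank E(K) = 1`, `Ш(E/K)[p^∞]` finite
  obtain ⟨hrankK, -, hshaK⟩ :=
    AcPConverseLinks.rank_corank_sha_baseChange_of_twist_L_one_ne_zero hKato W p hK hL1 hrank hsha
  -- a globally minimal model `W'` of `E^{(d_K)}`
  have hd : (NumberField.discr K : ℚ) ≠ 0 := by exact_mod_cast NumberField.discr_ne_zero K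
  obtain ⟨W', _, _, C, hC⟩ := exists_isGloballyMinimal_smul_eq_quadraticTwist W hd
  -- steps 5–6: Skinner–Urban twice + Prop. 12.1 (rank form): `ord_{s=1} L(E/K, s) = 1`
  have hEK : analyticRankEK W K = 1 :=
    analyticRankEK_eq_one_of_prop121_ordinary_OPEN_of_skinnerUrban_of_mordellWeilRank_eq_one h121 hSU
      W W' K p hp hgood hord hirr hram hK hsplit hHN hC hrankK hshaK
  -- `ord L(E/K) = ord L(E) + ord L(E^{(d_K)}) = ord L(E) + 0`
  rw [analyticRankEK_eq_add_of hE W K, analyticRank_eq_zero_of_entireLFunction_one_ne_zero _ hL1,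
    add_zero] at hEK
  exact hEK

/-- **Thm. 12.3, ordinary branch at `p ≥ 3` under (irr_ℚ) + (ram), RANK form** (print's hypothesis
for `A_g = E`, «`corank Sel_{λ^∞}(A_g) = 1, #Ш(A_g)[λ^∞] < ∞`» ⟺ `rank_ℤ E(ℚ) = 1 ∧ #Ш(E/ℚ)[p^∞] < ∞`
by the corank identity): granted the same binder and named print (Skinner–Urban in place of BCS25),
for `W/ℚ` globally minimal and `p ≥ 3` good ordinary with `E[p]` irreducible and (ram),
`rank_ℤ E(ℚ) = 1 ∧ #Ш(E/ℚ)[p^∞] < ∞ ⟹ ord_{s=1} L(E, s) = 1`.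
[claim: BurungaleSkinnerTianWan2024, status: under-review]
[cite: BurungaleSkinnerTianWan2024, Thm. 12.3 and its proof (p. 96) with (ram) (p. 14), Prop. 12.1 (p. 95; OPEN binder)]
[cite: SkinnerUrban2014, Thm. 3.6.9 (p. 45 of the author version)] -/
theorem analyticRank_eq_one_of_prop121_ordinary_OPEN_of_skinnerUrban_of_mordellWeilRank_eq_one
    (h121 : prop121_pConverse_of_charIdealLe_ordinary_OPEN.{0})
    (hSU : ∀ (W : WeierstrassCurve ℚ) [W.IsElliptic] [W.IsGloballyMinimal] (p : ℕ) [Fact p.Prime]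
      (κ : ZpExtension ℚ p) (γ : Field.absoluteGaloisGroup ℚ) (N : ℕ) [NeZero N]
      (f : CuspForm (CongruenceSubgroup.Gamma0 N) 2),
      skinner_urban_main_conjecture W p (κ := κ) (γ := γ) (f := f))
    (hpar : ∀ (W : WeierstrassCurve ℚ) [W.IsElliptic] (p : ℕ) [Fact p.Prime], p_parity W p)
    (hFH : friedbergHoffstein_exists_heegnerField_split_twist_ne_zero)
    (hKato : ∀ (W : WeierstrassCurve ℚ) [W.IsElliptic] (p : ℕ) [Fact p.Prime],
      kato_finite_of_L_one_ne_zero W p)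
    (hE : hasEntireLFunction_rat)
    (W : WeierstrassCurve ℚ) [W.IsElliptic] [W.IsGloballyMinimal] (p : ℕ) [Fact p.Prime]
    (hp : 3 ≤ p) (hgood : W.HasGoodReductionAtPrime p) (hord : ¬ (p : ℤ) ∣ W.frobeniusTrace p)
    (hirr : W.HasIrreducibleModPGaloisRep p)
    (hram : ∃ ℓ : ℕ, ∃ _ : Fact ℓ.Prime, ℓ ≠ p ∧ W.HasMultiplicativeReductionAtPrime ℓ ∧
      ¬ p ∣ padicValInt ℓ W.minimalDiscriminantInt)
    (hrank : W.mordellWeilRank = 1)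
    (hsha : Finite (AddCommGroup.primaryComponent W.sha p)) : W.analyticRank = 1 := by
  haveI := hsha
  exact analyticRank_eq_one_of_prop121_ordinary_OPEN_of_skinnerUrban_of_selmerCorank_eq_one h121 hSU
    hpar hFH hKato hE W p hp hgood hord hirr hram
    (selmerCorank_eq_one_of_mordellWeilRank_eq_one_of_finite W p hrank hsha) hsha

end Literature.NumberTheory.EllipticCurves.BurungaleSkinnerTianWan2024

end
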